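import Summits.ResolutionOfSingularities.ResolutionOfSingularities.Theorems.PurelyInseparableDim4PolyhedraBoundary
import HarnessLib

/-!
# [OURS · res-dim4-pi PR-9d] The strict endgame is CARDINALITY-FIRST-compatible:
  `Q-CF∀` (some cardinality-first positional strategy wins from everywhere) reduces to its interior phase

Cell `res-dim4-pi` (D-0157 DOOR 2), brick **PR-9d** (seat `res-dim4-p-10`, «width 10»; desk WORD #29 (b): the
open question `Q-CF∀` of the spine census — «one CARDINALITY-FIRST positional strategy winning Hironaka's pure
game from every position», cardinality-first = the support shadow of the MODE-1h rule of record: a permissible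
centre of LEAST cardinality, ties free).  Continues `PurelyInseparableDim4PolyhedraGame` / `…PolyhedraBoundary`
(PR-9c): the BOUNDARY LEMMA, which carried the strict threshold back to Spivakovsky's weak one, transports the
cardinality-first restriction VERBATIM — at a boundary position every permissible `J ⊆ I` contains the active
support `U` of the minimal points, so the permissible centres are exactly `U ∪ Γ'` with `Γ'` permissible for the
rescaled riders in `I ∖ U`, and «least `|J|`» is «least `|Γ'|`».

## What is proved (every index type `σ`, every threshold `t > 0`)
* `PolyhedraGame.IsCF t I J P` (permissible, inside `I`, of least cardinality among such), the inductive
  `ForcesCF` (forcing through cardinality-first moves only), `ForcesCF.forces`, `ForcesCF.weaken`, and the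
  NAMED HYPOTHESIS-SHAPE `WeakWinCF σ I` («cardinality-first forces the WEAK win Σ_I a ≤ t from every
  position» — NOT a printed theorem and NOT asserted; the census' EN-11 is its evidence at `q = 2`);
* `PolyhedraGame.isCF_minimalSupp`, `isCF_union_of_isCF_proj` — the two cardinality computations;
* **`PolyhedraGame.forcesCF_strict_of_boundary`** and **`forcesCF_strict_of_weakWinCF :
  (∀ I' ⊆ I, WeakWinCF σ I') → 0 < t → ∀ P, ForcesCF (StrictWon t I) t I P`** — so `Q-CF∀` for the strict
  (typed) game holds as soon as cardinality-first wins the WEAK game in every set of ≤ 4 active coordinates: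
  the only place where cardinality-first can fail is the INTERIOR phase (least degree `> t`).

[OURS · counted 0 · elementary · AI work weaker than expert review] A combinatorial game; NOTHING here proves
resolution of singularities in dimension ≥ 4 / characteristic `p`; nothing here asserts `Q-CF∀`.
bears_on: LADDER-RESOLUTION:D157-DOOR2 (res-dim4-pi · PR-9d). Supports stmt-ResolutionOfSingularities-16155
(helper).
-/

set_option linter.dupNamespace false -- mandated namespace of this single-conjunct summit

noncomputable section

namespace Summit.ResolutionOfSingularities.ResolutionOfSingularities.Theorems.PIDim4

namespace PolyhedraGame

open Finset
open Literature.AlgebraicGeometry.Resolution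
open Literature.AlgebraicGeometry.Resolution.CentreBlowup

variable {σ : Type} [DecidableEq σ]

/-! ## §1 Cardinality-first forcing -/

/-- A **cardinality-first** move at `P` in the active coordinates `I`: permissible, inside `I`, and of least
cardinality among the permissible `J' ⊆ I` (ties free). [folklore] -/
def IsCF (t : ℕ) (I J : Finset σ) (P : Pos σ) : Prop :=
  J ⊆ I ∧ Permissible t J P ∧ ∀ J' : Finset σ, J' ⊆ I → Permissible t J' P → J.card ≤ J'.card

/-- Player A forces reaching `W` through CARDINALITY-FIRST moves only. [folklore] -/
inductive ForcesCF (W : Pos σ → Prop) (t : ℕ) (I : Finset σ) : Pos σ → Prop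
  | won {P : Pos σ} : W P → ForcesCF W t I P
  | step {P : Pos σ} (J : Finset σ) : IsCF t I J P →
      (∀ j ∈ J, ForcesCF W t I (move t J j P)) → ForcesCF W t I P

/-- HYPOTHESIS-SHAPE (not a printed theorem, not asserted): cardinality-first forces the WEAK win in the
coordinates `I` from every position, every threshold. [folklore] -/
def WeakWinCF (σ : Type) [DecidableEq σ] (I : Finset σ) : Prop :=
  ∀ t : ℕ, 0 < t → ∀ P : Pos σ, ForcesCF (WeakWon t I) t I P

/-- Cardinality-first forcing is forcing. [folklore] -/
theorem ForcesCF.forces {W : Pos σ → Prop} {t : ℕ} {I : Finset σ} {P : Pos σ}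
    (h : ForcesCF W t I P) : Forces W t I P := by
  induction h with
  | won hP => exact Forces.won hP
  | step J hJ _ ih => exact Forces.step J hJ.1 hJ.2.1 ih

/-- Cardinality-first forcing composes. [folklore] -/
theorem ForcesCF.weaken {W W' : Pos σ → Prop} {t : ℕ} {I : Finset σ} {P : Pos σ}
    (h : ForcesCF W t I P) (hW : ∀ Q, W Q → ForcesCF W' t I Q) : ForcesCF W' t I P := by
  induction h with
  | won hP => exact hW _ hP
  | step J hJ _ ih => exact ForcesCF.step J hJ ih

/-! ## §2 The two cardinality computations at a boundary position -/

section Boundary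

variable {t : ℕ} {I : Finset σ}

/-- With no rider, `U` itself is a cardinality-first move (every permissible `J ⊆ I` contains `U`).
[folklore] -/
theorem isCF_minimalSupp (ht : 0 < t) {P : Pos σ} (hP : IsBoundary t I P) {U : Finset σ}
    (hU : minimalSupp t I P = U) (hR : riders t U P = ∅) : IsCF t I U P := by
  refine ⟨hU ▸ minimalSupp_subset P, permissible_minimalSupp_of_riders_eq_empty ht hP hU hR,
    fun J' hJ'I hJ' => Finset.card_le_card ?_⟩
  rw [← hU]
  exact minimalSupp_subset_of_permissible hJ'I hJ'

/-- With a rider present, a permissible `J' ⊆ I` leaves, after removing `U`, a set permissible for the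
projected position (threshold `t!`). [folklore] -/
theorem proj_permissible_sdiff {P : Pos σ} {U : Finset σ} (hU : minimalSupp t I P = U)
    (hR : (riders t U P).Nonempty) {J' : Finset σ} (hJ'I : J' ⊆ I) (hJ' : Permissible t J' P) :
    Permissible t.factorial (J' \ U) (proj t U P) := by
  have hUJ' : U ⊆ J' := hU ▸ minimalSupp_subset_of_permissible hJ'I hJ'
  have hsplit : ∀ b : σ →₀ ℕ, degIn J' b = degIn U b + degIn (J' \ U) b := fun b => by
    rw [← degIn_union_of_disjoint Finset.disjoint_sdiff b, Finset.union_sdiff_of_subset hUJ']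
  refine ⟨?_, fun y hy => ?_⟩
  · obtain ⟨b, hb⟩ := hR
    obtain ⟨hbP, hbU⟩ := mem_riders.mp hb
    have h1 := hJ'.2 b hbP
    rw [hsplit b] at h1
    have hpos : degIn (J' \ U) b ≠ 0 := by omega
    obtain ⟨i, hi, -⟩ : ∃ i ∈ J' \ U, b i ≠ 0 := by
      by_contra h
      push Not at h
      exact hpos (degIn_eq_zero_iff.mpr h)
    exact ⟨i, hi⟩
  · obtain ⟨b, hb, rfl⟩ := Finset.mem_image.mp hy
    obtain ⟨hbP, hbU⟩ := mem_riders.mp hb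
    have h1 := hJ'.2 b hbP
    rw [hsplit b] at h1
    unfold rescale
    rw [degIn_nsmul]
    obtain ⟨hcr, -⟩ := coef_mul_eq (t := t) hbU
    rw [← hcr]
    exact Nat.mul_le_mul_left _ (by omega)

/-- With a rider present, `U ∪ Γ` is cardinality-first at the ambient threshold when `Γ` is cardinality-first
for the projected position. [folklore] -/
theorem isCF_union_of_isCF_proj (ht : 0 < t) {P : Pos σ} (hP : IsBoundary t I P) {U Γ : Finset σ}
    (hU : minimalSupp t I P = U) (hR : (riders t U P).Nonempty)
    (hΓ : IsCF t.factorial (I \ U) Γ (proj t U P)) : IsCF t I (U ∪ Γ) P := by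
  have hUI : U ⊆ I := hU ▸ minimalSupp_subset P
  have hΓsub : Γ ⊆ I \ U := hΓ.1
  have hdisj : Disjoint U Γ :=
    Finset.disjoint_left.mpr fun i hiU hiΓ => (Finset.mem_sdiff.mp (hΓsub hiΓ)).2 hiU
  refine ⟨Finset.union_subset hUI (hΓsub.trans Finset.sdiff_subset),
    permissible_union_of_proj ht hP hU hΓsub hΓ.2.1, fun J' hJ'I hJ' => ?_⟩
  have hUJ' : U ⊆ J' := hU ▸ minimalSupp_subset_of_permissible hJ'I hJ'
  have h1 : (U ∪ Γ).card = U.card + Γ.card := Finset.card_union_of_disjoint hdisj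
  have h2 : (J' \ U).card + U.card = J'.card := Finset.card_sdiff_add_card_eq_card hUJ'
  have h3 : Γ.card ≤ (J' \ U).card :=
    hΓ.2.2 (J' \ U) (Finset.sdiff_subset_sdiff hJ'I subset_rfl) (proj_permissible_sdiff hU hR hJ'I hJ')
  omega

/-! ## §3 The cardinality-first boundary lemma -/

/-- **CARDINALITY-FIRST BOUNDARY LEMMA.** If cardinality-first wins the strict game in every proper subset of
active coordinates (every threshold), then cardinality-first forces the strict win from every BOUNDARY position
in `I`. (The proof of `forces_strict_of_boundary` with `J = U` resp. `J = U ∪ Γ`, both cardinality-first by §2.)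
[folklore] -/
theorem forcesCF_strict_of_boundary (ht : 0 < t)
    (hsub : ∀ I' : Finset σ, I' ⊆ I → I'.card < I.card → ∀ L : ℕ, 0 < L → ∀ Y : Pos σ,
      ForcesCF (StrictWon L I') L I' Y) :
    ∀ (m : ℕ) (P : Pos σ), IsBoundary t I P → (I \ minimalSupp t I P).card = m →
      ForcesCF (StrictWon t I) t I P := by
  intro m
  induction m using Nat.strong_induction_on with
  | _ m innerIH =>
    intro P hP hm
    set U₀ := minimalSupp t I P with hU₀def
    have hU₀I : U₀ ⊆ I := minimalSupp_subset P
    have hU₀ne : U₀.Nonempty := minimalSupp_nonempty ht hP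
    have hcard : (I \ U₀).card < I.card := by
      have h1 : (I \ U₀).card + U₀.card = I.card := Finset.card_sdiff_add_card_eq_card hU₀I
      have h2 : 0 < U₀.card := Finset.card_pos.mpr hU₀ne
      omega
    have D : ForcesCF (StrictWon t.factorial (I \ U₀)) t.factorial (I \ U₀) (proj t U₀ P) :=
      hsub (I \ U₀) Finset.sdiff_subset hcard t.factorial (Nat.factorial_pos t) _
    -- playing `U₀` settles every rider-free position with this `U₀`
    have noRider : ∀ Q : Pos σ, IsBoundary t I Q → minimalSupp t I Q = U₀ → riders t U₀ Q = ∅ →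
        ForcesCF (StrictWon t I) t I Q := fun Q hQ hUQ hR => by
      have hCF : IsCF t I U₀ Q := isCF_minimalSupp ht hQ hUQ hR
      exact ForcesCF.step U₀ hCF fun j hj =>
        ForcesCF.won (strictWon_move_of_mem_minimalSupp hU₀I hCF.2.1 (hUQ ▸ hj))
    suffices KS : ∀ Y : Pos σ, ForcesCF (StrictWon t.factorial (I \ U₀)) t.factorial (I \ U₀) Y →
        ∀ Q : Pos σ, IsBoundary t I Q → minimalSupp t I Q = U₀ → (I \ minimalSupp t I Q).card = m →
          proj t U₀ Q = Y → ForcesCF (StrictWon t I) t I Q from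
      KS _ D P hP rfl hm rfl
    intro Y hY
    induction hY with
    | won hW =>
      intro Q hQ hUQ _ hproj
      rcases hW with hYe | hYlt
      · have hR : riders t U₀ Q = ∅ := by
          rw [← hproj] at hYe
          exact Finset.image_eq_empty.mp hYe
        exact noRider Q hQ hUQ hR
      · rw [← hproj] at hYlt
        exact ForcesCF.won (strictWon_of_proj_strictWon hU₀I hYlt)
    | @step Y Γ hΓCF _ ih =>
      intro Q hQ hUQ hmQ hproj
      rw [← hproj] at hΓCF ih
      -- a rider-free position is settled by `U₀` alone (the sub-derivation's step would not be least)
      rcases Classical.em (riders t U₀ Q = ∅) with hR | hR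
      · exact noRider Q hQ hUQ hR
      have hRne : (riders t U₀ Q).Nonempty := Finset.nonempty_iff_ne_empty.mpr hR
      have hΓ : Γ ⊆ I \ U₀ := hΓCF.1
      have hpermΓ : Permissible t.factorial Γ (proj t U₀ Q) := hΓCF.2.1
      have hdisj : Disjoint U₀ Γ :=
        Finset.disjoint_left.mpr fun i hiU hiΓ => (Finset.mem_sdiff.mp (hΓ hiΓ)).2 hiU
      have hCF : IsCF t I (U₀ ∪ Γ) Q := isCF_union_of_isCF_proj ht hQ hUQ hRne hΓCF
      have hJI : U₀ ∪ Γ ⊆ I := hCF.1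
      have hpermJ : Permissible t (U₀ ∪ Γ) Q := hCF.2.1
      refine ForcesCF.step (U₀ ∪ Γ) hCF fun j hj => ?_
      rcases Finset.mem_union.mp hj with hjU | hjΓ
      · exact ForcesCF.won (strictWon_move_of_mem_minimalSupp hJI hpermJ (hUQ ▸ hjU))
      · have hjI : j ∈ I := (Finset.mem_sdiff.mp (hΓ hjΓ)).1
        have hjU : j ∉ U₀ := (Finset.mem_sdiff.mp (hΓ hjΓ)).2
        have hjUQ : j ∉ minimalSupp t I Q := by rw [hUQ]; exact hjU
        rcases Classical.em (StrictWon t I (move t (U₀ ∪ Γ) j Q)) with hnw | hnw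
        · exact ForcesCF.won hnw
        have hQ' : IsBoundary t I (move t (U₀ ∪ Γ) j Q) := isBoundary_move hQ hJI hpermJ hjI hjUQ hnw
        have hmono : U₀ ⊆ minimalSupp t I (move t (U₀ ∪ Γ) j Q) := by
          have h := minimalSupp_subset_move hJI hpermJ hjI hjUQ
          rwa [hUQ] at h
        rcases Classical.em (minimalSupp t I (move t (U₀ ∪ Γ) j Q) = U₀) with hUeq | hUeq
        · refine ih j hjΓ _ hQ' hUeq ?_ ?_
          · rw [hUeq]; rw [hUQ] at hmQ; exact hmQ
          · exact proj_move hjU hdisj hpermΓ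
        · have hlt : (I \ minimalSupp t I (move t (U₀ ∪ Γ) j Q)).card < m := by
            have hss : U₀ ⊂ minimalSupp t I (move t (U₀ ∪ Γ) j Q) :=
              Finset.ssubset_iff_subset_ne.mpr ⟨hmono, fun h => hUeq h.symm⟩
            have hsub' : minimalSupp t I (move t (U₀ ∪ Γ) j Q) ⊆ I := minimalSupp_subset _
            have h1 := Finset.card_sdiff_add_card_eq_card hsub'
            have h2 := Finset.card_sdiff_add_card_eq_card hU₀I
            have h3 := Finset.card_lt_card hss
            rw [hUQ] at hmQ
            omega
          exact innerIH _ hlt _ hQ' rfl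

end Boundary

/-! ## §4 Strict from weak, cardinality-first -/

/-- **`Q-CF∀` REDUCES TO ITS INTERIOR PHASE.** If cardinality-first forces the WEAK win (least active degree
`≤ t`) from every position in every `I' ⊆ I`, then cardinality-first forces the STRICT win from every position
in `I`, every threshold `t > 0`. [folklore] -/
theorem forcesCF_strict_of_weakWinCF (I : Finset σ) (hweak : ∀ I' : Finset σ, I' ⊆ I → WeakWinCF σ I')
    {t : ℕ} (ht : 0 < t) (P : Pos σ) : ForcesCF (StrictWon t I) t I P := by
  suffices main : ∀ (n : ℕ) (I' : Finset σ), I' ⊆ I → I'.card = n → ∀ L : ℕ, 0 < L → ∀ Y : Pos σ,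
      ForcesCF (StrictWon L I') L I' Y from main _ I subset_rfl rfl t ht P
  intro n
  induction n using Nat.strong_induction_on with
  | _ n IH =>
    intro I' hI'I hcard L hL Y
    have hsub : ∀ I'' : Finset σ, I'' ⊆ I' → I''.card < I'.card → ∀ L' : ℕ, 0 < L' → ∀ Z : Pos σ,
        ForcesCF (StrictWon L' I'') L' I'' Z :=
      fun I'' hI'' hlt L' hL' Z => IH I''.card (hcard ▸ hlt) I'' (hI''.trans hI'I) rfl L' hL' Z
    refine (hweak I' hI'I L hL Y).weaken fun Q hQ => ?_
    rcases Classical.em (StrictWon L I' Q) with hsw | hsw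
    · exact ForcesCF.won hsw
    · have hB : IsBoundary L I' Q := by
        refine ⟨fun a ha => ?_, ?_⟩
        · by_contra h
          push Not at h
          exact hsw (Or.inr ⟨a, ha, h⟩)
        · rcases hQ with hQe | ⟨a, ha, hle⟩
          · exact absurd (Or.inl hQe) hsw
          · have hnlt : ¬ degIn I' a < L := fun h => hsw (Or.inr ⟨a, ha, h⟩)
            exact ⟨a, ha, by omega⟩
      exact forcesCF_strict_of_boundary hL hsub _ Q hB rfl

end PolyhedraGame

end Summit.ResolutionOfSingularities.ResolutionOfSingularities.Theorems.PIDim4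

end
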